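import Summits.ResolutionOfSingularities.ResolutionOfSingularities.Theses.FoliationDescent
import Literature.AlgebraicGeometry.Resolution.RegularLocalRingsUFD
import HarnessLib

/-!
# Crux `FolLU` (stmt-ResolutionOfSingularities-17081), line `birth` — stub `stub_multiplier_inCtr`

**The `p`-multiplier of a saturated derivation lies in the local ring at the centre.**
Setting: `k ⊆ K` fields, `O` a valuation ring of `K`, `S ⊆ O` a `k`-subalgebra with
`Frac S = K`, and `S_c` the local ring of `S` at the centre of `O` (fractions `a / b`, `a b ∈ S`,
`b` a unit of `O`), assumed regular. If a map `δ : K → K` sends `S_c` into `S_c`, is SATURATED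
(no non-zero non-unit `t ∈ S_c` divides all values `δ x`, `x ∈ S_c`) and satisfies
`δ^[p] = c · δ` on `K`, then `c ∈ S_c` [Rudakov–Shafarevich 1976, §1: the multiplier `a` of a
`p`-closed vector field `D^p = a D` is a regular function once `D` has no divisorial part].

Proof (lowest terms in a UFD).
* `MultiplierInCtr.exists_ctr_subalgebra`: `S_c` is realised inside `K` as Mathlib's
  `Localization.subalgebra.ofField` of `S` at the prime `𝔭 = S ∩ 𝔪_O`; membership is the
  displayed fraction condition because a member of `O` is a unit of `O` iff it is non-zero with
  inverse in `O` (`MultiplierInCtr.notMem_maximalIdeal_iff`); it is isomorphic to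
  `Localization.AtPrime 𝔭` (`IsLocalization.algEquiv`), hence regular, hence a UFD
  (Auslander–Buchsbaum, tree file `Literature/AlgebraicGeometry/Resolution/RegularLocalRingsUFD`).
* `MultiplierInCtr.mem_of_mul_values_mem`: write `c = a / b` in lowest terms in the UFD `S_c`
  (`IsFractionRing.num/den`). From `c · δ x ∈ S_c` get `b ∣ a · δ x`, so `b ∣ δ x` for every
  `x ∈ S_c`. If `b` is a unit, `c ∈ S_c`; otherwise `b` is a non-zero non-unit of `S_c` (a unit of
  `O` lying in `S_c` is a unit of `S_c`), and saturation produces `x ∈ S_c` with `δ x / b ∉ S_c`,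
  contradicting `b ∣ δ x`.
* `stub_multiplier_inCtr` assembles the two (`c · δ x = δ^[p] x ∈ S_c` by iterating PRESERVES).
  The hypotheses `p.Prime`, `S.FG`, `δ ≠ 0` and the derivation structure of `δ` are not used.

References: A. N. Rudakov, I. R. Shafarevich, *Inseparable morphisms of algebraic surfaces*,
Izv. Akad. Nauk SSSR 40 (1976), §1 [cite: RudakovShafarevich1976, §1];
H. Matsumura, *Commutative ring theory*, Thm. 20.3 [cite: Matsumura1987, Thm. 20.3].
-/

set_option linter.dupNamespace false

noncomputable section

namespace Summit.ResolutionOfSingularities.ResolutionOfSingularities.Theorems.FolLU.MultiplierInCtr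

variable {K : Type} [Field K]

/-- A member `u` of a valuation subring `O ⊆ K` is a unit of `O` iff `u ≠ 0` and `u⁻¹ ∈ O`.
[folklore] -/
theorem isUnit_iff_inv_mem (O : ValuationSubring K) (u : O) :
    IsUnit u ↔ (u : K) ≠ 0 ∧ (u : K)⁻¹ ∈ O := by
  constructor
  · rintro ⟨⟨u, v, huv, -⟩, rfl⟩
    have h : (u : K) * (v : K) = 1 := by
      have := congrArg Subtype.val huv
      simpa using this
    refine ⟨left_ne_zero_of_mul_eq_one h, ?_⟩
    rw [inv_eq_of_mul_eq_one_right h]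
    exact v.2
  · rintro ⟨h0, hinv⟩
    exact IsUnit.of_mul_eq_one ⟨(u : K)⁻¹, hinv⟩ (Subtype.ext (mul_inv_cancel₀ h0))

/-- A member `u` of a valuation subring `O ⊆ K` lies outside the maximal ideal of `O` iff
`u ≠ 0` and `u⁻¹ ∈ O`. [folklore] -/
theorem notMem_maximalIdeal_iff (O : ValuationSubring K) (u : O) :
    u ∉ IsLocalRing.maximalIdeal O ↔ (u : K) ≠ 0 ∧ (u : K)⁻¹ ∈ O := by
  rw [IsLocalRing.mem_maximalIdeal, mem_nonunits_iff, not_not, isUnit_iff_inv_mem]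

variable {k : Type} [Field k] [Algebra k K]

/-- The local ring `S_c` of the model `S` at the centre of `O`, realised inside `K` as the
localisation (`Localization.subalgebra.ofField`) of `S` at the prime `S ∩ m_O`: its members are
exactly the fractions `a / b` with `a b ∈ S` and `b` a unit of `O`, and it is a UFD as soon as
the abstract localisation is a regular local ring (Auslander–Buchsbaum).
[cite: Matsumura1987, Thm. 20.3] -/
theorem exists_ctr_subalgebra (O : ValuationSubring K) (S : Subalgebra k K)
    (hS : S.toSubring ≤ O.toSubring) (hfrac : IsFractionRing S K)
    (hreg : IsRegularLocalRing
      (Localization.AtPrime (Ideal.comap (Subring.inclusion hS) (IsLocalRing.maximalIdeal O)))) :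
    ∃ T : Subalgebra S.toSubring K,
      (∀ x : K, x ∈ T ↔ ∃ a b : K, a ∈ S ∧ b ∈ S ∧ b ≠ 0 ∧ b⁻¹ ∈ O ∧ x = a / b) ∧
      UniqueFactorizationMonoid T := by
  haveI : IsFractionRing S.toSubring K := hfrac
  haveI := hreg
  set P : Ideal S.toSubring := Ideal.comap (Subring.inclusion hS) (IsLocalRing.maximalIdeal O)
    with hPdef
  have hP : P.primeCompl ≤ nonZeroDivisors S.toSubring := P.primeCompl_le_nonZeroDivisors
  refine ⟨Localization.subalgebra.ofField K P.primeCompl hP, ?_, ?_⟩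
  · intro x
    change (x ∈ {x | ∃ (a s : S.toSubring) (_ : s ∈ P.primeCompl),
      x = algebraMap _ K a * (algebraMap _ K s)⁻¹}) ↔ _
    constructor
    · rintro ⟨a, s, hs, rfl⟩
      have hs' : Subring.inclusion hS s ∉ IsLocalRing.maximalIdeal O := hs
      rw [notMem_maximalIdeal_iff] at hs'
      exact ⟨a, s, a.2, s.2, hs'.1, hs'.2, by rw [div_eq_mul_inv]; rfl⟩
    · rintro ⟨a, b, ha, hb, hb0, hbinv, rfl⟩
      refine ⟨⟨a, ha⟩, ⟨b, hb⟩, ?_, by rw [div_eq_mul_inv]; rfl⟩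
      show Subring.inclusion hS ⟨b, hb⟩ ∉ IsLocalRing.maximalIdeal O
      rw [notMem_maximalIdeal_iff]
      exact ⟨hb0, hbinv⟩
  · exact Literature.AlgebraicGeometry.Resolution.uniqueFactorizationMonoid_of_isRegularLocalRing _
      (IsRegularLocalRing.of_ringEquiv
        (IsLocalization.algEquiv P.primeCompl (Localization.AtPrime P)
          (Localization.subalgebra.ofField K P.primeCompl hP)).toRingEquiv)

/-- **Lowest-terms argument.** Let `T ⊆ K` be a subring with fraction field `K` which is a UFD
and whose members that are units of `O` are units of `T`; let `δ : K → K` map `T` into `T` with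
`c * δ x ∈ T` for all `x ∈ T`, and suppose no non-zero non-unit of `T` divides all the values
`δ x`, `x ∈ T`. Then `c ∈ T`: writing `c = a / b` in lowest terms, `b` divides every value.
[cite: RudakovShafarevich1976, §1] -/
theorem mem_of_mul_values_mem {A : Type} [CommRing A] [Algebra A K] (T : Subalgebra A K)
    [IsFractionRing T K] (hufd : UniqueFactorizationMonoid T) (O : ValuationSubring K)
    (δ : K → K) (c : K)
    (hinv : ∀ t ∈ T, t ≠ 0 → t⁻¹ ∈ O → t⁻¹ ∈ T)
    (hval : ∀ x ∈ T, δ x ∈ T) (hmul : ∀ x ∈ T, c * δ x ∈ T)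
    (hsat : ∀ t ∈ T, ¬ (t ≠ 0 ∧ t⁻¹ ∈ O) → t ≠ 0 → ∃ x ∈ T, δ x / t ∉ T) :
    c ∈ T := by
  classical
  haveI := hufd
  obtain ⟨b, hb⟩ : ∃ b : T, (IsFractionRing.den T c : T) = b := ⟨_, rfl⟩
  have hrel : IsRelPrime (IsFractionRing.num T c) b := hb ▸ IsFractionRing.num_den_reduced T c
  have hcK : (IsFractionRing.num T c : K) / (b : K) = c := by
    have h := IsFractionRing.mk'_num_den' T c
    rwa [Subalgebra.algebraMap_apply, Subalgebra.algebraMap_apply, hb] at h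
  have hb0 : (b : K) ≠ 0 := by
    have : b ≠ 0 := hb ▸ nonZeroDivisors.coe_ne_zero _
    exact fun h => this (ZeroMemClass.coe_eq_zero.mp h)
  by_cases hu : IsUnit b
  · obtain ⟨t, ht⟩ := (IsFractionRing.isUnit_den_iff c).mp (by rw [hb]; exact hu)
    rw [← ht]
    exact t.2
  · exfalso
    have hbT : (b : K) ∈ T := b.2
    have hnot : ¬ ((b : K) ≠ 0 ∧ ((b : K))⁻¹ ∈ O) := by
      rintro ⟨-, hbinv⟩
      apply hu
      have hbinvT := hinv _ hbT hb0 hbinv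
      exact IsUnit.of_mul_eq_one ⟨((b : K))⁻¹, hbinvT⟩ (Subtype.ext (mul_inv_cancel₀ hb0))
    obtain ⟨x, hxT, hx⟩ := hsat _ hbT hnot hb0
    apply hx
    have hd := hval x hxT
    have hm := hmul x hxT
    have hnum : (IsFractionRing.num T c : K) = c * (b : K) := (div_eq_iff hb0).mp hcK
    have hdvd : b ∣ IsFractionRing.num T c * ⟨δ x, hd⟩ := by
      refine ⟨⟨c * δ x, hm⟩, ?_⟩
      apply Subtype.ext
      simp only [MulMemClass.coe_mul, hnum]
      ring
    have hdvd' : b ∣ ⟨δ x, hd⟩ := hrel.symm.dvd_of_dvd_mul_left hdvd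
    obtain ⟨w, hw⟩ := hdvd'
    have hw' : δ x = (b : K) * (w : K) := by
      have := congrArg Subtype.val hw
      simpa using this
    have : δ x / (b : K) = (w : K) := by
      rw [hw']
      field_simp
    rw [this]
    exact w.2

end Summit.ResolutionOfSingularities.ResolutionOfSingularities.Theorems.FolLU.MultiplierInCtr

namespace Summit.ResolutionOfSingularities.ResolutionOfSingularities.Theorems.FolLU

/-- **Stub `stub_multiplier_inCtr` of the crux `FolLU` (line `birth`), expanded form of
`MultiplierInCtrStatement`.** For a valuation ring `O` of `K/k`, a model `S ⊆ O` of `K` whose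
local ring `S_c` at the centre of `O` is regular, and a derivation `δ` of `K` preserving `S_c`,
saturated at the centre, with `δ^[p] = c · δ` on `K`: the multiplier `c` lies in `S_c`
(write `c = a / b` in lowest terms in the UFD `S_c`; `b` divides every value `δ x`, so `b` is a
unit by saturation). [cite: RudakovShafarevich1976, §1] -/
theorem stub_multiplier_inCtr :
  ∀ p : ℕ, p.Prime → ∀ (k K : Type) [Field k] [Field K] [Algebra k K]
    (O : ValuationSubring K) (S : Subalgebra k K) (hS : S.toSubring ≤ O.toSubring)
    (δ : Derivation k K K) (c : K), S.FG → IsFractionRing S K →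
    IsRegularLocalRing
      (Localization.AtPrime (Ideal.comap (Subring.inclusion hS) (IsLocalRing.maximalIdeal O))) →
    δ ≠ 0 →
    (∀ x : K, (∃ a b : K, a ∈ S ∧ b ∈ S ∧ b ≠ 0 ∧ b⁻¹ ∈ O ∧ x = a / b) →
      ∃ a b : K, a ∈ S ∧ b ∈ S ∧ b ≠ 0 ∧ b⁻¹ ∈ O ∧ δ x = a / b) →
    (∀ t : K, ((∃ a b : K, a ∈ S ∧ b ∈ S ∧ b ≠ 0 ∧ b⁻¹ ∈ O ∧ t = a / b) ∧ ¬ (t ≠ 0 ∧ t⁻¹ ∈ O)) →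
      t ≠ 0 → ∃ x : K, (∃ a b : K, a ∈ S ∧ b ∈ S ∧ b ≠ 0 ∧ b⁻¹ ∈ O ∧ x = a / b) ∧
        ¬ (∃ a b : K, a ∈ S ∧ b ∈ S ∧ b ≠ 0 ∧ b⁻¹ ∈ O ∧ δ x / t = a / b)) →
    (∀ x : K, (⇑δ)^[p] x = c * δ x) →
    ∃ a b : K, a ∈ S ∧ b ∈ S ∧ b ≠ 0 ∧ b⁻¹ ∈ O ∧ c = a / b := by
  intro p _hp k K _ _ _ O S hS δ c _hfg hfrac hreg _hδ hpres hsat hpc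
  obtain ⟨T, hmem, hufd⟩ := MultiplierInCtr.exists_ctr_subalgebra O S hS hfrac hreg
  haveI : IsFractionRing S.toSubring K := hfrac
  refine (hmem c).mp (MultiplierInCtr.mem_of_mul_values_mem T hufd O δ c ?_ ?_ ?_ ?_)
  · intro t ht ht0 htinv
    rw [hmem] at ht ⊢
    obtain ⟨a, b, ha, hb, hb0, hbinv, rfl⟩ := ht
    have ha0 : a ≠ 0 := by
      rintro rfl
      simp at ht0
    refine ⟨b, a, hb, ha, ha0, ?_, inv_div a b⟩
    have : a⁻¹ = (a / b)⁻¹ * b⁻¹ := by field_simp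
    rw [this]
    exact mul_mem htinv hbinv
  · intro x hx
    rw [hmem] at hx ⊢
    exact hpres x hx
  · intro x hx
    have hiter : ∀ n : ℕ, ∀ y : K, y ∈ T → (⇑δ)^[n] y ∈ T := by
      intro n
      induction n with
      | zero => intro y hy; simpa using hy
      | succ n ih =>
        intro y hy
        rw [Function.iterate_succ_apply']
        have := ih y hy
        rw [hmem] at this ⊢
        exact hpres _ this
    have := hiter p x hx
    rwa [hpc x] at this
  · intro t ht hnot ht0
    rw [hmem] at ht
    obtain ⟨x, hx, hx'⟩ := hsat t ⟨ht, hnot⟩ ht0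
    exact ⟨x, (hmem x).mpr hx, fun h => hx' ((hmem _).mp h)⟩

end Summit.ResolutionOfSingularities.ResolutionOfSingularities.Theorems.FolLU

end
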